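import Summits.QuantumFields.GaugeBoot.Rows.GLYZc2D3BindGen
import Summits.QuantumFields.GaugeBoot.Eqs.BindKitN
import HarnessLib

/-!
# Gauge-boot: CODED torus-binding lemma for the glyz-c2-rp-3D certificate replays (rows C32–C33, C51–C60)

Cell `pub-gaugeboot` (HOME `run/shared/lean/pub/pub-gaugeboot/`), seat lean1 (binding layer; FANOUT-PLAN A126 (2), A148 (2),
A155 (2)).

HONEST FRAMING (page 1 of every file of this cell): certified bounds on lattice expectations at STATED coupling,
gauge group, dimension and torus size; NOT a mass gap, NOT a continuum limit, NOT a string tension, NOT large `N`.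
The venture is explicitly NOT Yang–Mills-summit-bearing (barriers `FixedCouplingUltralocality`,
`PerturbativeInvisibility`).

`GLYZc2D3BindGen.heq_of_rowsOK` compares lean3's sparse problem rows with lean2's rows as lists of (WORD, coefficient)
pairs; for the 346-row glyz-c2-rp-3D files (rows of up to 102 terms, 7 550 non-zeros) the kernel cost of that permutation
test on words is ≈ 400 s per β.  This module gives the same conclusion from a CODED check: lean2's rows are ℕ-coded
(`Eqs/BindKitN`: term `(code, num, den)`, word = `BindN.wdg 3 code`), and lean1's labels are digit codes too
(`GLYZc2D3.labelCode`, word = `GLYZc2D3.dw code`); the two decoders agree on all 1449 labels (`labelN_eq_wdg`, one kernel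
check), so a row-by-row permutation test on (CODE, coefficient) pairs of naturals and rationals suffices
(`rowOKC`, `heq_of_rowsOKC`) — no word is decoded inside the per-row checks.  Columns of lean3's rows are strictly
increasing (`colsOK`, one pass), which gives distinctness and range.
-/

noncomputable section

open Literature.MathematicalPhysics.QuantumFieldTheory
open Summit.QuantumFields.GaugeBoot.Certificates Summit.QuantumFields.GaugeBoot.Certificates.Sparse

namespace Summit.QuantumFields.GaugeBoot

namespace GLYZc2D3

/-! ## The two digit-code decoders agree on the labels -/

set_option maxHeartbeats 0 in
/-- Kernel check, columns `v < 725`: lean1's label word is lean2's decoding of the same digit code. -/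
theorem labelN_eq_wdg_0 : ∀ v < 725, labelN v = BindN.wdg 3 (labelCode v) := by
  decide +kernel

set_option maxHeartbeats 0 in
/-- Kernel check, columns `725 ≤ v < 1449`. -/
theorem labelN_eq_wdg_1 : ∀ v < 1449, 725 ≤ v → labelN v = BindN.wdg 3 (labelCode v) := by
  decide +kernel

/-- **The label words through lean2's decoder**: `labelN v = BindN.wdg 3 (labelCode v)` for every column `v < 1449`. -/
theorem labelN_eq_wdg (v : ℕ) (hv : v < 1449) : labelN v = BindN.wdg 3 (labelCode v) := by
  rcases Nat.lt_or_ge v 725 with h | h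
  · exact labelN_eq_wdg_0 v h
  · exact labelN_eq_wdg_1 v hv h

/-! ## The coded per-row data check -/

/-- Column check of a sparse row in one pass: columns strictly increasing and `< 1449`. -/
def colsOK : List (ℕ × ℚ) → Bool
  | [] => true
  | [p] => decide (p.1 < 1449)
  | p :: q :: rest => decide (p.1 < q.1) && decide (p.1 < 1449) && colsOK (q :: rest)

/-- `colsOK` gives pairwise `<` of the columns (hence distinctness) and the range bound. -/
theorem colsOK_sound : ∀ l : List (ℕ × ℚ), colsOK l = true →
    (l.map Prod.fst).Pairwise (· < ·) ∧ ∀ p ∈ l, p.1 < 1449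
  | [], _ => by simp
  | [p], h => by simpa [colsOK] using h
  | p :: q :: rest, h => by
    simp only [colsOK, Bool.and_eq_true, decide_eq_true_eq] at h
    obtain ⟨⟨hpq, hp⟩, hrest⟩ := h
    obtain ⟨hpw, hlt⟩ := colsOK_sound (q :: rest) hrest
    refine ⟨?_, ?_⟩
    · rw [List.map_cons, List.pairwise_cons]
      refine ⟨fun b hb => ?_, hpw⟩
      rw [List.map_cons, List.mem_cons] at hb
      rcases hb with hb | hb
      · rw [hb]; exact hpq
      · rw [List.map_cons, List.pairwise_cons] at hpw
        exact lt_trans hpq (hpw.1 b hb)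
    · intro r hr
      rcases List.mem_cons.mp hr with hr | hr
      · rw [hr]; exact hp
      · exact hlt r hr

/-- A sparse problem row with its columns replaced by the label CODES: `[(labelCode v, c), …]`. -/
def rwCodes (r : List (ℕ × ℚ)) : List (ℕ × ℚ) := r.map fun p => (labelCode p.1, p.2)

/-- lean2's coded terms `(code, num, den)` as `(code, num / den)` pairs. -/
def tCodes (ts : List (ℕ × ℤ × ℕ)) : List (ℕ × ℚ) := ts.map fun t => (t.1, (t.2.1 : ℚ) / t.2.2)

/-- **The coded per-row data check**: right-hand side `0`, columns strictly increasing and `< 1449`, and the label-coded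
sparse row is a permutation of lean2's coded row (pairs of a natural and a rational; no word decoding). -/
def rowOKC (rw : ℚ × List (ℕ × ℚ)) (ts : List (ℕ × ℤ × ℕ)) : Bool :=
  decide (rw.1 = 0) && colsOK rw.2 && decide ((rwCodes rw.2).Perm (tCodes ts))

/-- lean2's decoded row, as (word, coefficient) pairs, is the coded row read through `BindN.wdg 3`. -/
theorem ePairs_decW (ts : List (ℕ × ℤ × ℕ)) :
    ePairs (BindN.decW 3 ts) = (tCodes ts).map fun q => (BindN.wdg 3 q.1, q.2) := by
  simp [ePairs, BindN.decW, tCodes, List.map_map, Function.comp_def]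

/-- The `c1` components of a decoded coded row vanish. -/
theorem decW_c1 (ts : List (ℕ × ℤ × ℕ)) : ∀ t ∈ BindN.decW 3 ts, t.2.2 = 0 := by
  intro t ht
  simp only [BindN.decW, List.mem_map] at ht
  obtain ⟨s, _, rfl⟩ := ht
  rfl

variable (β : ℝ) (L : ℕ) [NeZero L]

/-- **From the coded data check to lean3's `heq`**: if every sparse row `rows e` (`e < N`) passes `rowOKC` against a
coded row `crow e` whose decoding vanishes on the torus state (`rowSum β L (BindN.decW 3 (crow e)) = 0`, lean2's
`rowSum_row`), then `Σ_v (rows e)_v · y β L v = rhs_e`. -/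
theorem heq_of_rowsOKC {N : ℕ} (rows : ℕ → ℚ × List (ℕ × ℚ)) (crow : ℕ → List (ℕ × ℤ × ℕ))
    (hok : ∀ e < N, rowOKC (rows e) (crow e) = true)
    (hE : ∀ e < N, rowSum β L (BindN.decW 3 (crow e)) = 0) (e : Fin N) :
    ∑ v : Fin 1449, (sget (rows e.val).2 v.val : ℝ) * y β L v = ((rows e.val).1 : ℝ) := by
  have hok' := hok e.val e.isLt
  simp only [rowOKC, Bool.and_eq_true, decide_eq_true_eq] at hok'
  obtain ⟨⟨hrhs, hcols⟩, hperm⟩ := hok'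
  obtain ⟨hpw, hlt⟩ := colsOK_sound _ hcols
  have hnd : ((rows e.val).2.map Prod.fst).Nodup := hpw.imp fun h => Nat.ne_of_lt h
  rw [hrhs, Rat.cast_zero]
  have hy : ∀ v : Fin 1449, y β L v = Rung0D3.W β L (labelN v.val) := fun v => rfl
  simp only [hy]
  rw [GLYZc1D3.sum_sget_mul (fun k => Rung0D3.W β L (labelN k)) _ hnd fun p hp => hlt p hp]
  have hmap : ((rows e.val).2.map fun p => (p.2 : ℝ) * Rung0D3.W β L (labelN p.1)) =
      (rwCodes (rows e.val).2).map fun q => (q.2 : ℝ) * Rung0D3.W β L (BindN.wdg 3 q.1) := by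
    rw [rwCodes, List.map_map]
    refine List.map_congr_left fun p hp => ?_
    simp only [Function.comp_apply]
    rw [labelN_eq_wdg p.1 (hlt p hp)]
  rw [hmap, (hperm.map _).sum_eq]
  have hmap2 : ((tCodes (crow e.val)).map fun q => (q.2 : ℝ) * Rung0D3.W β L (BindN.wdg 3 q.1)) =
      (ePairs (BindN.decW 3 (crow e.val))).map fun q => (q.2 : ℝ) * Rung0D3.W β L q.1 := by
    rw [ePairs_decW, List.map_map]; rfl
  rw [hmap2, sum_ePairs β L _ (decW_c1 _)]
  exact hE e.val e.isLt

/-- **The labels through lean2's decoder, `Fin`-indexed**: `label v = BindN.wdg 3 (labelCode v)` — the form in which the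
per-β bindings `GLYZc2D3BindB<tag>` meet lean2's coded rows (`B<tag>.Ecode`, decoded by `BindN.decW 3`). -/
theorem label_eq_wdg (v : Fin 1449) : label v = BindN.wdg 3 (labelCode v.val) :=
  labelN_eq_wdg v.val v.isLt

end GLYZc2D3

end Summit.QuantumFields.GaugeBoot

end
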